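import Summits.BirchSwinnertonDyer.BirchSwinnertonDyer.Theorems.KatoDescentPotSupersingularCartanMuRoadRealDoors
import Literature.NumberTheory.EllipticCurves.FineSelmerMuRoadCartanImageThreeNoGrowth
import HarnessLib

/-!
# KT `TameCoatesSujathaResidue` (stmt-19916; U₀-ns node 19202 → parent 19982) and K9 `WildCoatesSujathaResidue` (19942 → 19197) —
# the `p = 3` Cartan μ-road DOORS with Coates–Sujatha Thm. 3.4 DISCHARGED and Iwasawa's growth theorem REMOVED: statement (A) at
# `(W, 3)` and U₀ `MissingUpperBoundAt W 3` from the mod-3 image predicate, a complex conjugation and ONE classical `μ = 0`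
# hypothesis on the maximal real subfield `ℚ(P)` of `ℚ(W[3])`, modulo Ferrero–Washington ALONE (+ Kato A161-fine / GZK / modularity for U₀)
# (cell `bsd-potss`, seat `bsd-potss-k8t-c4` g22; route-free; `--supports stmt-BirchSwinnertonDyer-19982 --as helper`; closes nothing)

HONEST FRAMING. Route-free THEOREMS ONLY (no definition, no named fact, no `sorry`). The doors of k9-c4 g18 (`CartanMuRoadRealDoors`,
p626162) and this seat's g16 KT twins (`CartanMuRoadRealDoorsTprime`, p628994) display the named facts `hCS` (Coates–Sujatha 2005 Thm. 3.4),
`hFW` (Ferrero–Washington) and — on `3Nn` rows with the octic input `ℚ(P)` alone — `hI` (Iwasawa's growth theorem). This seat's g22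
Literature chain makes two of them unnecessary: `CoatesSujatha2005.thm34_…_holds` (p694085: growth-form `μ = 0` ⟹ bounded `p`-ranks at finite
level, p693085, ∘ g21's bounded-rank Thm. 3.4, p688203) and the hI-free descents (`ClassicalMuVanishesIffBoundedRank`: «`μ = 0` iff bounded
ranks», both directions, no structure theory; `…KleinDescentNoGrowth`, `…NonsplitCartanImageNoGrowth`, `FineSelmerMuRoadCartanImageThreeNoGrowth`).
THIS FILE re-issues the doors with ONLY `hFW` displayed (and `hKatoA hGZK hmod` for U₀): §1 (A) at `(W,3)` for any elliptic `W/ℚ` (K9 and KT);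
§2 U₀ on a rank-`0` (t′) row (KT; the fine-Selmer port of Kato 14.5 (3) re-homed privately, as in g16); §3 U₀ on a rank-`0` O6 row (K9 courtesy,
via k9-c4 g5's `WildFineSelmerSupersingularCMAnchor.missingUpperBoundAt_wild_of_conjA`). On the KT census the `3Nn` doors serve the two `p = 3`
Conj-A residue rows of 19916 (130095bp1, 470304m1). Nothing is asserted about any curve; (A), Conjecture A and BSD are proved for no curve here.
[cite: CoatesSujatha2005, Thm. 3.4 (§3)] [cite: Kato2004Asterisque, Thm. 14.5 (3) (p. 236), Thm. 12.5 (3) (p. 222), 14.14 (p. 243)]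
[cite: Serre1972, §2.2, §5.2 (iii)–(iv)] [cite: Washington1997, §7.5, §13.1, §13.3 Prop. 13.23] [cite: Miller2011LMS, Def. 1.1]
-/

set_option linter.dupNamespace false
set_option autoImplicit false

noncomputable section

open scoped Classical NumberField
open Field IntermediateField WeierstrassCurve Literature.NumberTheory.EllipticCurves
  Literature.NumberTheory.EllipticCurves.Rank1Residual
  Literature.NumberTheory.EllipticCurves.Rank1Residual.Typed
  Literature.NumberTheory.GaloisRepresentations Literature.NumberTheory.SerreUniformity
  Literature.NumberTheory.IwasawaTheory
  Summit.BirchSwinnertonDyer.Rank1Residual Summit.BirchSwinnertonDyer.Rank1Residual.Additive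

namespace Summit.BirchSwinnertonDyer.BirchSwinnertonDyer.Theorems.CartanMuRoadRealDoorsNoGrowth

/-! ### §1 Statement (A) at `(W, 3)` from the image predicate and `μ = 0` on `ℚ(W[3])⁺`, modulo Ferrero–Washington alone -/

section Doors

variable (W : WeierstrassCurve ℚ) [W.IsElliptic]

/-- **(A) at `(W,3)` on a `3Ns` row from ONE classical `μ`-hypothesis, modulo Ferrero–Washington alone** (`hCS` discharged):
`HasSplitCartanNormalizerModPImage W 3`, a complex conjugation `c`, and `μ = 0` for every cyclotomic `ℤ_3`-extension of the fixed field of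
`c|_{ℚ(W[3])}` (`ℚ(W[3])⁺ = ℚ(P)`, `P` a real `3`-torsion point) give statement (A) for `W` at `3`. CONDITIONAL on `hFW`; (A) asserted for no curve.
[cite: CoatesSujatha2005, Thm. 3.4 (§3)] [cite: Serre1972, §2.2, §5.2 (iv)] [cite: Washington1997, §7.5, §13.1] -/
theorem conjA_three_of_hasSplitCartanNormalizerModPImage_of_realMu
    (hFW : ferreroWashington1979_classicalMuVanishes)
    (himg : HasSplitCartanNormalizerModPImage W 3) {c : absoluteGaloisGroup ℚ}
    (hc : IsComplexConjugation (Rat.castHom ℝ) c)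
    (hμ : ∀ κE : ZpExtension ↥(fixedField (Subgroup.zpowers (absRestrictNormalHom (W.divisionField 3) c))) 3,
      κE.IsCyclotomic → ClassicalMuVanishes κE)
    (κ : ZpExtension ℚ 3) (hκ : κ.IsCyclotomic) :
    ∃ (γ : absoluteGaloisGroup ℚ) (D : W.FineSelmerDualData κ γ),
      Module.Finite ℤ_[3] (RestrictScalars ℤ_[3] (IwasawaAlgebra 3) D.X) :=
  haveI : Fact (Nat.Prime 3) := ⟨Nat.prime_three⟩
  CoatesSujatha2005.fineSelmerDual_moduleFinite_of_hasSplitCartanNormalizerModPImage_three_of_ferreroWashington hFW W himg c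
    (CartanMuRoadRealDoors.smul_smul_of_isComplexConjugation hc)
    (CartanMuRoadRealDoors.exists_smul_ne_of_isComplexConjugation (by decide) hc)
    (CartanMuRoadRealDoors.exists_smul_ne_neg_of_isComplexConjugation (by decide) hc) hμ κ hκ

/-- **(A) at `(W,3)` on a `3Nn` row from ONE classical `μ`-hypothesis (the octic `ℚ(P)` ALONE), modulo Ferrero–Washington alone — NO growth
theorem** (`hCS` discharged, `hI` removed): `HasModPImageEqNonsplitCartanNormalizer W 3`, a complex conjugation `c`, `μ = 0` for every cyclotomic
`ℤ_3`-extension of the fixed field of `c|_{ℚ(W[3])}` (`= ℚ(P)`, degree `8`). CONDITIONAL on `hFW`; (A) asserted for no curve.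
[cite: CoatesSujatha2005, Thm. 3.4 (§3)] [cite: Serre1972, §2.2, §5.2 (iv)] [cite: Washington1997, §13.1, §13.3 Prop. 13.23] -/
theorem conjA_three_of_hasModPImageEqNonsplitCartanNormalizer_of_realMu
    (hFW : ferreroWashington1979_classicalMuVanishes)
    (himg : HasModPImageEqNonsplitCartanNormalizer W 3) {c : absoluteGaloisGroup ℚ}
    (hc : IsComplexConjugation (Rat.castHom ℝ) c)
    (hμ : ∀ κE : ZpExtension ↥(fixedField (Subgroup.zpowers (absRestrictNormalHom (W.divisionField 3) c))) 3,
      κE.IsCyclotomic → ClassicalMuVanishes κE)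
    (κ : ZpExtension ℚ 3) (hκ : κ.IsCyclotomic) :
    ∃ (γ : absoluteGaloisGroup ℚ) (D : W.FineSelmerDualData κ γ),
      Module.Finite ℤ_[3] (RestrictScalars ℤ_[3] (IwasawaAlgebra 3) D.X) :=
  haveI : Fact (Nat.Prime 3) := ⟨Nat.prime_three⟩
  CoatesSujatha2005.fineSelmerDual_moduleFinite_of_hasModPImageEqNonsplitCartanNormalizer_three_of_ferreroWashington' hFW W himg c
    (CartanMuRoadRealDoors.smul_smul_of_isComplexConjugation hc)
    (CartanMuRoadRealDoors.exists_smul_ne_of_isComplexConjugation (by decide) hc)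
    (CartanMuRoadRealDoors.exists_smul_ne_neg_of_isComplexConjugation (by decide) hc) hμ κ hκ

end Doors

/-! ### §2 KT: U₀ `MissingUpperBoundAt W 3` at a (t′) Cartan residue row through (A) -/

/-- **The fine-Selmer port of Kato 14.5 (3) on an irreducible rank-`0` (t′) row** (private verbatim re-homing of
`Theorems.missingUpperBoundAt_tame_of_irreducible_of_fineSelmerDual_fg`, whose module imports the route; as in g16's `CartanMuRoadRealDoorsTprime`).
[cite: Kato2004Asterisque, Thm. 14.5 (3) (p. 236), Thm. 12.5 (3) (p. 222), 14.14 (p. 243)] [cite: Lim2017FineSelmer, §3] [cite: Miller2011LMS, Def. 1.1] -/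
private theorem missingUpperBoundAt_tame_of_irreducible_of_fineSelmerDual_fg
    (hKatoA :
      Kato2004.rankZero_padicValNat_sha_add_padicValNat_tamagawa_le_of_additive_potGood_of_irreducible_of_fineSelmerDual_fg)
    (hGZK : rank_eq_analyticRank_of_analyticRank_le_one) (hmod : hasEntireLFunction_rat)
    (W : WeierstrassCurve ℚ) [W.IsElliptic] [W.IsGloballyMinimal] (p : ℕ) [Fact p.Prime]
    (hr : W.analyticRank = 0) (hp2 : p ≠ 2) (hadd : Addv W p) (hT : SubTprime W p)
    (hirr : W.HasIrreducibleModPGaloisRep p)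
    (hA : ∀ (κ : ZpExtension ℚ p), κ.IsCyclotomic →
      ∃ (γ : Field.absoluteGaloisGroup ℚ) (D : W.FineSelmerDualData κ γ),
        Module.Finite ℤ_[p] (RestrictScalars ℤ_[p] (IwasawaAlgebra p) D.X)) :
    MissingUpperBoundAt W p := by
  have hO5 : ClassO5 W p := ⟨hp2, hadd, Or.inr hT⟩
  have hL : W.entireLFunction 1 ≠ 0 := (W.analyticRank_eq_zero_iff_holds (hmod W)).mp hr
  obtain ⟨hmw, hfin⟩ := hGZK W (by rw [hr]; exact zero_le_one)
  haveI : Finite W.sha := hfin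
  have hmw0 : W.mordellWeilRank = 0 := by rw [hmw, hr]
  obtain ⟨q₀, hq₀, hle⟩ := hKatoA W p hp2 hadd.1 hadd.2 hO5.padicValRat_j_nonneg hirr hA hL hfin
  have hΩpos : 0 < W.realPeriodRat := W.realPeriodRat_pos_holds
  have hΩ : (W.realPeriodRat : ℂ) ≠ 0 := by exact_mod_cast hΩpos.ne'
  have hc0 : 0 < W.tamagawaProduct := W.tamagawaProduct_pos_holds
  have ht0 : 0 < W.torsionOrder := W.torsionOrder_pos_holds
  have hq₀0 : q₀ ≠ 0 := by
    rintro rfl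
    rw [Rat.cast_zero, div_eq_zero_iff] at hq₀
    exact hq₀.elim hL hΩ
  refine ⟨q₀ * (W.torsionOrder : ℚ) ^ 2 / (W.tamagawaProduct : ℚ), ?_, ?_⟩
  · have hLq : W.entireLFunction 1 = (q₀ : ℂ) * (W.realPeriodRat : ℂ) := by
      rw [← hq₀, div_mul_cancel₀ _ hΩ]
    rw [shaAn_def, W.leadingLCoeff_eq_of_analyticRank_eq_zero hr,
      W.regulator_eq_one_of_rank_zero hmw0, hLq]
    push_cast
    field_simp
  · have ht : (W.torsionOrder : ℚ) ≠ 0 := by exact_mod_cast ht0.ne'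
    have hcq : (W.tamagawaProduct : ℚ) ≠ 0 := by exact_mod_cast hc0.ne'
    have hsha : padicValNat p (Nat.card (AddCommGroup.primaryComponent W.sha p)) =
        padicValNat p W.shaOrder := by
      unfold WeierstrassCurve.shaOrder
      exact padicValNat_card_addPrimaryComponent p
    have htors : (padicValNat p W.torsionOrder : ℤ) = 0 := by
      exact_mod_cast padicValNat_torsionOrder_eq_zero_of_irreducible W p hirr
    have hv : padicValRat p (q₀ * (W.torsionOrder : ℚ) ^ 2 / (W.tamagawaProduct : ℚ)) =
        padicValRat p q₀ + 2 * (padicValNat p W.torsionOrder : ℤ) -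
          (padicValNat p W.tamagawaProduct : ℤ) := by
      rw [padicValRat.div (mul_ne_zero hq₀0 (pow_ne_zero 2 ht)) hcq,
        padicValRat.mul hq₀0 (pow_ne_zero 2 ht), pow_two, padicValRat.mul ht ht,
        padicValRat.of_nat, padicValRat.of_nat]
      ring
    rw [hv, ← hsha, htors]
    linarith

section UpperTame

variable (W : WeierstrassCurve ℚ) [W.IsElliptic] [W.IsGloballyMinimal]

/-- **U₀ at a `3Ns` (t′) residue row from ONE classical `μ`-hypothesis, modulo Ferrero–Washington alone** (`hCS` discharged):
`MissingUpperBoundAt W 3` for a rank-`0` (t′) row (`Addv W 3`, `SubTprime W 3`) with `W[3]` irreducible and `3Ns` image, from Kato's fine-Selmer reading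
(`hKatoA`), GZK (`hGZK`), modularity (`hmod`), Ferrero–Washington (`hFW`) — named facts — and `μ = 0` for the cyclotomic `ℤ_3`-extension of the maximal
real subfield of `ℚ(W[3])` (`hμ`). CONDITIONAL; nothing booked; BSD for no curve.
[cite: Kato2004Asterisque, Thm. 14.5 (3) (p. 236), Thm. 12.5 (3) (p. 222)] [cite: CoatesSujatha2005, Thm. 3.4 (§3)] [cite: Serre1972, §5.2 (iv)] -/
theorem missingUpperBoundAt_three_tame_of_hasSplitCartanNormalizerModPImage_of_realMu
    (hKatoA : Kato2004.rankZero_padicValNat_sha_add_padicValNat_tamagawa_le_of_additive_potGood_of_irreducible_of_fineSelmerDual_fg)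
    (hGZK : rank_eq_analyticRank_of_analyticRank_le_one) (hmod : hasEntireLFunction_rat)
    (hFW : ferreroWashington1979_classicalMuVanishes) [Fact (3 : ℕ).Prime]
    (hr : W.analyticRank = 0) (hadd : Addv W 3) (hT : SubTprime W 3) (hirr : W.HasIrreducibleModPGaloisRep 3)
    (himg : HasSplitCartanNormalizerModPImage W 3) {c : absoluteGaloisGroup ℚ} (hc : IsComplexConjugation (Rat.castHom ℝ) c)
    (hμ : ∀ κE : ZpExtension ↥(fixedField (Subgroup.zpowers (absRestrictNormalHom (W.divisionField 3) c))) 3,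
      κE.IsCyclotomic → ClassicalMuVanishes κE) :
    MissingUpperBoundAt W 3 :=
  missingUpperBoundAt_tame_of_irreducible_of_fineSelmerDual_fg hKatoA hGZK hmod W 3 hr (by decide) hadd hT hirr
    (conjA_three_of_hasSplitCartanNormalizerModPImage_of_realMu W hFW himg hc hμ)

/-- **U₀ at a `3Nn` (t′) residue row from ONE classical `μ`-hypothesis (octic `ℚ(P)` ALONE), modulo Ferrero–Washington alone — NO growth theorem**
(the road for the KT residue rows 130095bp1 / 470304m1; `hCS` discharged, `hI` removed). CONDITIONAL; nothing booked; BSD for no curve.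
[cite: Kato2004Asterisque, Thm. 14.5 (3) (p. 236)] [cite: CoatesSujatha2005, Thm. 3.4 (§3)] [cite: Washington1997, §13.1, §13.3 Prop. 13.23] -/
theorem missingUpperBoundAt_three_tame_of_hasModPImageEqNonsplitCartanNormalizer_of_realMu
    (hKatoA : Kato2004.rankZero_padicValNat_sha_add_padicValNat_tamagawa_le_of_additive_potGood_of_irreducible_of_fineSelmerDual_fg)
    (hGZK : rank_eq_analyticRank_of_analyticRank_le_one) (hmod : hasEntireLFunction_rat)
    (hFW : ferreroWashington1979_classicalMuVanishes) [Fact (3 : ℕ).Prime]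
    (hr : W.analyticRank = 0) (hadd : Addv W 3) (hT : SubTprime W 3) (hirr : W.HasIrreducibleModPGaloisRep 3)
    (himg : HasModPImageEqNonsplitCartanNormalizer W 3) {c : absoluteGaloisGroup ℚ}
    (hc : IsComplexConjugation (Rat.castHom ℝ) c)
    (hμ : ∀ κE : ZpExtension ↥(fixedField (Subgroup.zpowers (absRestrictNormalHom (W.divisionField 3) c))) 3,
      κE.IsCyclotomic → ClassicalMuVanishes κE) :
    MissingUpperBoundAt W 3 :=
  missingUpperBoundAt_tame_of_irreducible_of_fineSelmerDual_fg hKatoA hGZK hmod W 3 hr (by decide) hadd hT hirr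
    (conjA_three_of_hasModPImageEqNonsplitCartanNormalizer_of_realMu W hFW himg hc hμ)

end UpperTame

/-! ### §3 K9 (courtesy): U₀ `MissingUpperBoundAt W 3` at an O6 Cartan residue row through (A) -/

section UpperWild

variable (W : WeierstrassCurve ℚ) [W.IsElliptic] [W.IsGloballyMinimal]

/-- **U₀ at a `3Ns` O6 residue row from ONE classical `μ`-hypothesis, modulo Ferrero–Washington alone** (K9 twin; `hCS` discharged).
CONDITIONAL; nothing booked; BSD for no curve. [cite: Kato2004Asterisque, Thm. 14.5 (3) (p. 236), Thm. 12.5 (3) (p. 222)]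
[cite: CoatesSujatha2005, Thm. 3.4 (§3)] [cite: Serre1972, §5.2 (iv)] -/
theorem missingUpperBoundAt_three_wild_of_hasSplitCartanNormalizerModPImage_of_realMu
    (hKatoA : Kato2004.rankZero_padicValNat_sha_add_padicValNat_tamagawa_le_of_additive_potGood_of_irreducible_of_fineSelmerDual_fg)
    (hGZK : rank_eq_analyticRank_of_analyticRank_le_one) (hmod : hasEntireLFunction_rat)
    (hFW : ferreroWashington1979_classicalMuVanishes) [Fact (3 : ℕ).Prime]
    (hr : W.analyticRank = 0) (hO : ClassO6 W 3) (hirr : W.HasIrreducibleModPGaloisRep 3)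
    (himg : HasSplitCartanNormalizerModPImage W 3) {c : absoluteGaloisGroup ℚ} (hc : IsComplexConjugation (Rat.castHom ℝ) c)
    (hμ : ∀ κE : ZpExtension ↥(fixedField (Subgroup.zpowers (absRestrictNormalHom (W.divisionField 3) c))) 3,
      κE.IsCyclotomic → ClassicalMuVanishes κE) :
    MissingUpperBoundAt W 3 :=
  WildFineSelmerSupersingularCMAnchor.missingUpperBoundAt_wild_of_conjA hKatoA hGZK hmod W hr hO hirr
    (conjA_three_of_hasSplitCartanNormalizerModPImage_of_realMu W hFW himg hc hμ)

/-- **U₀ at a `3Nn` O6 residue row from ONE classical `μ`-hypothesis (octic `ℚ(P)` ALONE), modulo Ferrero–Washington alone — NO growth theorem**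
(K9 twin; `hCS` discharged, `hI` removed). CONDITIONAL; nothing booked; BSD for no curve. [cite: Kato2004Asterisque, Thm. 14.5 (3) (p. 236)]
[cite: CoatesSujatha2005, Thm. 3.4 (§3)] [cite: Washington1997, §13.1, §13.3 Prop. 13.23] -/
theorem missingUpperBoundAt_three_wild_of_hasModPImageEqNonsplitCartanNormalizer_of_realMu
    (hKatoA : Kato2004.rankZero_padicValNat_sha_add_padicValNat_tamagawa_le_of_additive_potGood_of_irreducible_of_fineSelmerDual_fg)
    (hGZK : rank_eq_analyticRank_of_analyticRank_le_one) (hmod : hasEntireLFunction_rat)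
    (hFW : ferreroWashington1979_classicalMuVanishes) [Fact (3 : ℕ).Prime]
    (hr : W.analyticRank = 0) (hO : ClassO6 W 3) (hirr : W.HasIrreducibleModPGaloisRep 3)
    (himg : HasModPImageEqNonsplitCartanNormalizer W 3) {c : absoluteGaloisGroup ℚ}
    (hc : IsComplexConjugation (Rat.castHom ℝ) c)
    (hμ : ∀ κE : ZpExtension ↥(fixedField (Subgroup.zpowers (absRestrictNormalHom (W.divisionField 3) c))) 3,
      κE.IsCyclotomic → ClassicalMuVanishes κE) :
    MissingUpperBoundAt W 3 :=
  WildFineSelmerSupersingularCMAnchor.missingUpperBoundAt_wild_of_conjA hKatoA hGZK hmod W hr hO hirr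
    (conjA_three_of_hasModPImageEqNonsplitCartanNormalizer_of_realMu W hFW himg hc hμ)

end UpperWild

end Summit.BirchSwinnertonDyer.BirchSwinnertonDyer.Theorems.CartanMuRoadRealDoorsNoGrowth

end
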